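import Summits.MatrixMultiplication.MatrixMultiplication.Theorems.AsymptoticRankCWSkewPairRanges
import Summits.MatrixMultiplication.MatrixMultiplication.Theorems.AsymptoticRankCWBThesisSkewSplit
import Literature.Computability.AlgebraicComplexity.AsymptoticRankZariskiClosedProofs

/-!
# The torus pencil through `T_cw,2` and `ε`, I: entries and finite-or-all sublevel sets
(route `MatrixMultiplication/AsymptoticRankCW`; support item `BSkewDominatesCw` =
stmt-MatrixMultiplication-18009, `R̃(T_cw,2) ≤ R̃(ε)`, stub `stub_skewDominatesCw` of the line
`skew_anchor` of the crux `BThesis` = stmt-MatrixMultiplication-0588)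

The two tensors compared by `BSkewDominatesCw` are the points `ρ = 1` and `ρ = -1` of ONE pencil of
tensors on `Fin 3`, all supported on the six permutation cells:

  `T_ρ (a, a+1, a+2) = 1`, `T_ρ (a, a+2, a+1) = ρ`, `0` elsewhere

(written INLINE below as `fun a b c => (if b = a+1 ∧ c = a+2 then 1 else 0) + ρ * (if b = a+2 ∧ c = a+1
then 1 else 0)`): `T_1 = |ε| ≅ T_cw,2` (`cwTensor_restrictsTo_levi`, `levi_restrictsTo_cwTensor`,
CGLV 2022 §3.2), `T_{-1} = ε` (the route's inline Levi-Civita tensor), `T_0 ≅ ⟨3⟩`.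

What is proved here (sorry-free, from tree facts only):

* `sum_mul_pencil` — the support formula; `pencil_neg_one_eq_leviCivita`, `pencil_one_eq_absLeviCivita`,
  `asymptoticRank_pencil_one : R̃(T_1) = R̃(T_cw,2)`; `three_le_asymptoticRank_pencil : 3 ≤ R̃(T_ρ)`
  (flattening), `asymptoticRank_pencil_zero : R̃(T_0) = 3`, `asymptoticRank_pencil_le : R̃(T_ρ) ≤ 27`.
* **Finite-or-all** `pencil_sublevel_finite_or_all`: for every real `r`, `{ρ : R̃(T_ρ) ≤ r}` is finite
  or all of `ℂ` — the PROVED Zariski-closedness of the sublevel sets of `R̃`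
  (Christandl–Hoeberechts–Nieuwboer–Vrana–Zuiddam 2025 Thm 1.2,
  `chnvz_zariskiClosed_asymptoticRank_le_holds`) pulled back along the degree-`1` map `ρ ↦ T_ρ`:
  a separating polynomial in the `27` entries becomes a non-zero univariate polynomial in `ρ`.
* `bSkewDominatesCw_iff_pencil`: item 18009 is exactly the comparison `R̃(T_1) ≤ R̃(T_{-1})` of the
  two orbifold points of the pencil. Part II (`AsymptoticRankCWSkewPencilDichotomy`) derives the
  dichotomy at `r = 3` and the generic domination of both anchors by the pencil.

References: M. Christandl, K. Hoeberechts, H. Nieuwboer, P. Vrana, J. Zuiddam, *Asymptotic tensor rank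
is characterized by polynomials*, STOC 2025 = arXiv:2411.15789, Thm 1.2; A. Conner, F. Gesmundo,
J. M. Landsberg, E. Ventura, comput. complexity 31 (2022) = arXiv:1909.04785, §3.2.
-/

set_option linter.dupNamespace false

noncomputable section

namespace Summit.MatrixMultiplication.MatrixMultiplication.Theorems

open Module Submodule
open Literature.Computability.AlgebraicComplexity
open Literature.Barriers.MatrixMultiplication (flatteningRank_le_asymptoticRank
  asymptoticRank_le_of_polyDegeneratesTo)
open Summit.MatrixMultiplication.MatrixMultiplication.Theses.AsymptoticRankCW
  (BThesis BDet3AsymptoticRank BSkewDominatesCw)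

/-! ## The pencil: entries, the three special members -/

section Entries

/-- **Support formula**: a triple sum against `T_ρ` is the sum over its six cells,
`∑ f·T_ρ = f(0,1,2) + f(1,2,0) + f(2,0,1) + ρ (f(0,2,1) + f(1,0,2) + f(2,1,0))`. [folklore] -/
theorem sum_mul_pencil (ρ : ℂ) (f : Fin 3 → Fin 3 → Fin 3 → ℂ) :
    ∑ a, ∑ b, ∑ c, f a b c *
      (fun a b c : Fin 3 => (if b = a + 1 ∧ c = a + 2 then (1 : ℂ) else 0) +
        ρ * (if b = a + 2 ∧ c = a + 1 then (1 : ℂ) else 0)) a b c =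
      f 0 1 2 + f 1 2 0 + f 2 0 1 + ρ * (f 0 2 1 + f 1 0 2 + f 2 1 0) := by
  simp only [Fin.sum_univ_three]
  simp [Fin.ext_iff]
  ring

/-- `T_{-1} = ε`, the route's inline Levi-Civita tensor. [folklore] -/
theorem pencil_neg_one_eq_leviCivita :
    (fun a b c : Fin 3 => (if b = a + 1 ∧ c = a + 2 then (1 : ℂ) else 0) +
        (-1) * (if b = a + 2 ∧ c = a + 1 then (1 : ℂ) else 0)) =
      fun a b c : Fin 3 => (if b = a + 1 ∧ c = a + 2 then (1 : ℂ) else 0) -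
        (if b = a + 2 ∧ c = a + 1 then 1 else 0) := by
  funext a b c
  ring

/-- `T_1 = |ε|`, the indicator of the six permutation cells. [folklore] -/
theorem pencil_one_eq_absLeviCivita :
    (fun a b c : Fin 3 => (if b = a + 1 ∧ c = a + 2 then (1 : ℂ) else 0) +
        1 * (if b = a + 2 ∧ c = a + 1 then (1 : ℂ) else 0)) =
      fun i j k : Fin 3 => ((|leviCivita3 i j k| : ℤ) : ℂ) := by
  funext a b c
  rw [abs_leviCivita3]
  fin_cases a <;> fin_cases b <;> fin_cases c <;> simp

/-- `2|ε| = 2 · T_1` (the tensor `2∑_σ a_{σ(0)} ⊗ b_{σ(1)} ⊗ c_{σ(2)} ≅ T_cw,2` of CGLV §3.2).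
[cite: ConnerGesmundoLandsbergVentura2022, §3.2 (proof of Lemma 2.4)] -/
theorem two_mul_absLeviCivita_eq_pencil_one :
    (fun i j k : Fin 3 => 2 * ((|leviCivita3 i j k| : ℤ) : ℂ)) =
      fun a b c : Fin 3 => 2 * (fun a b c : Fin 3 => (if b = a + 1 ∧ c = a + 2 then (1 : ℂ) else 0) +
        1 * (if b = a + 2 ∧ c = a + 1 then (1 : ℂ) else 0)) a b c := by
  rw [pencil_one_eq_absLeviCivita]

/-- **`R̃(T_1) = R̃(T_cw,2)`**: `T_1 = |ε|`, `2|ε| ≅ T_cw,2` (CGLV §3.2, both changes of bases in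
tree) and non-zero scalars are restriction-equivalences. [cite: ConnerGesmundoLandsbergVentura2022, §3.2 (proof of Lemma 2.4)] -/
theorem asymptoticRank_pencil_one :
    asymptoticRank (fun a b c : Fin 3 => (if b = a + 1 ∧ c = a + 2 then (1 : ℂ) else 0) +
        1 * (if b = a + 2 ∧ c = a + 1 then (1 : ℂ) else 0)) = asymptoticRank (cwTensor ℂ 2) := by
  have h1 : asymptoticRank (fun a b c : Fin 3 => 2 *
      (fun a b c : Fin 3 => (if b = a + 1 ∧ c = a + 2 then (1 : ℂ) else 0) +
        1 * (if b = a + 2 ∧ c = a + 1 then (1 : ℂ) else 0)) a b c) =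
      asymptoticRank (fun a b c : Fin 3 => (if b = a + 1 ∧ c = a + 2 then (1 : ℂ) else 0) +
        1 * (if b = a + 2 ∧ c = a + 1 then (1 : ℂ) else 0)) :=
    asymptoticRank_eq_of_restrictsTo (tensorRestrictsTo_const_mul _ _)
      (tensorRestrictsTo_of_const_mul _ (by norm_num))
  have h2 : asymptoticRank (cwTensor ℂ 2) =
      asymptoticRank (fun i j k : Fin 3 => 2 * ((|leviCivita3 i j k| : ℤ) : ℂ)) :=
    asymptoticRank_eq_of_restrictsTo levi_restrictsTo_cwTensor cwTensor_restrictsTo_levi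
  rw [h2, two_mul_absLeviCivita_eq_pencil_one, h1]

/-- `BSkewDominatesCw` is the comparison of the two orbifold points `ρ = 1` (`≅ T_cw,2`) and
`ρ = -1` (`= ε`) of the pencil: `BSkewDominatesCw ↔ R̃(T_1) ≤ R̃(T_{-1})`. [folklore] -/
theorem bSkewDominatesCw_iff_pencil :
    BSkewDominatesCw ↔
      asymptoticRank (fun a b c : Fin 3 => (if b = a + 1 ∧ c = a + 2 then (1 : ℂ) else 0) +
          1 * (if b = a + 2 ∧ c = a + 1 then (1 : ℂ) else 0)) ≤
        asymptoticRank (fun a b c : Fin 3 => (if b = a + 1 ∧ c = a + 2 then (1 : ℂ) else 0) +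
          (-1) * (if b = a + 2 ∧ c = a + 1 then (1 : ℂ) else 0)) := by
  rw [asymptoticRank_pencil_one, pencil_neg_one_eq_leviCivita]
  rfl

/-- **`ζ⁽¹⁾(T_ρ) = 3`** for every `ρ`: slice `a` is the only `x`-slice with a non-zero entry at
`(a+1, a+2)` (value `1`), so the three slices are linearly independent. [folklore] -/
theorem flatteningRank_pencil (ρ : ℂ) :
    flatteningRank (fun a b c : Fin 3 => (if b = a + 1 ∧ c = a + 2 then (1 : ℂ) else 0) +
      ρ * (if b = a + 2 ∧ c = a + 1 then (1 : ℂ) else 0)) = 3 := by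
  have hli : LinearIndependent ℂ (xSlices (fun a b c : Fin 3 =>
      (if b = a + 1 ∧ c = a + 2 then (1 : ℂ) else 0) +
        ρ * (if b = a + 2 ∧ c = a + 1 then (1 : ℂ) else 0))) := by
    rw [Fintype.linearIndependent_iff]
    intro g hg a
    have hev : ∀ b c : Fin 3, (∑ i : Fin 3, g i * ((if b = i + 1 ∧ c = i + 2 then (1 : ℂ) else 0) +
        ρ * (if b = i + 2 ∧ c = i + 1 then (1 : ℂ) else 0))) = 0 := by
      intro b c
      have := congrFun hg (b, c)
      simpa [Finset.sum_apply, Pi.smul_apply, xSlices_apply, smul_eq_mul] using this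
    have h := hev (a + 1) (a + 2)
    fin_cases a <;> simpa [Fin.sum_univ_three] using h
  unfold flatteningRank
  rw [finrank_span_eq_card hli, Fintype.card_fin]

/-- **`3 ≤ R̃(T_ρ)`** for every member of the pencil (flattening lower bound; gauge points are
spectral points, CVZ 2023 Example 1.4). [cite: ChristandlVranaZuiddam2023, Example 1.4] -/
theorem three_le_asymptoticRank_pencil (ρ : ℂ) :
    (3 : ℝ) ≤ asymptoticRank (fun a b c : Fin 3 => (if b = a + 1 ∧ c = a + 2 then (1 : ℂ) else 0) +
      ρ * (if b = a + 2 ∧ c = a + 1 then (1 : ℂ) else 0)) := by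
  have h := flatteningRank_le_asymptoticRank (fun a b c : Fin 3 =>
    (if b = a + 1 ∧ c = a + 2 then (1 : ℂ) else 0) + ρ * (if b = a + 2 ∧ c = a + 1 then (1 : ℂ) else 0))
  rw [flatteningRank_pencil] at h
  exact_mod_cast h

/-- `T_0` (the three even cells) is a sum of three triads, so `R(T_0) ≤ 3`. [folklore] -/
theorem tensorRank_pencil_zero_le :
    tensorRank (fun a b c : Fin 3 => (if b = a + 1 ∧ c = a + 2 then (1 : ℂ) else 0) +
      0 * (if b = a + 2 ∧ c = a + 1 then (1 : ℂ) else 0)) ≤ 3 := by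
  refine tensorRank_le_of_eq_sum (fun i a => if a = i then (1 : ℂ) else 0)
    (fun i b => if b = i + 1 then (1 : ℂ) else 0) (fun i c => if c = i + 2 then (1 : ℂ) else 0) ?_
  funext a b c
  simp only [Finset.sum_apply, triad_apply, Fin.sum_univ_three]
  fin_cases a <;> fin_cases b <;> fin_cases c <;> simp

/-- **`R̃(T_0) = 3`** (`T_0 ≅ ⟨3⟩`): `3 ≤ R̃ ≤ R ≤ 3`. [folklore] -/
theorem asymptoticRank_pencil_zero :
    asymptoticRank (fun a b c : Fin 3 => (if b = a + 1 ∧ c = a + 2 then (1 : ℂ) else 0) +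
      0 * (if b = a + 2 ∧ c = a + 1 then (1 : ℂ) else 0)) = 3 := by
  refine le_antisymm ?_ (three_le_asymptoticRank_pencil 0)
  refine (asymptoticRank_le_algBorderRank _).trans ?_
  refine (Nat.cast_le.mpr (algBorderRank_le_tensorRank _)).trans ?_
  exact_mod_cast tensorRank_pencil_zero_le

/-- Format bound: `R̃(T_ρ) ≤ R(T_ρ) ≤ 27`. [folklore] -/
theorem asymptoticRank_pencil_le (ρ : ℂ) :
    asymptoticRank (fun a b c : Fin 3 => (if b = a + 1 ∧ c = a + 2 then (1 : ℂ) else 0) +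
      ρ * (if b = a + 2 ∧ c = a + 1 then (1 : ℂ) else 0)) ≤ 27 := by
  refine (asymptoticRank_le_algBorderRank _).trans ?_
  refine (Nat.cast_le.mpr (algBorderRank_le_tensorRank _)).trans ?_
  have h := tensorRank_le_card (fun a b c : Fin 3 =>
    (if b = a + 1 ∧ c = a + 2 then (1 : ℂ) else 0) + ρ * (if b = a + 2 ∧ c = a + 1 then (1 : ℂ) else 0))
  simp only [Fintype.card_fin] at h
  exact_mod_cast h

end Entries

/-! ## Zariski-closedness on the pencil: finite-or-all -/

section Semicontinuity

/-- The entries of `T_ρ` as degree-`≤ 1` polynomials in `ρ`, evaluated: the entry polynomial at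
`(a,b,c)` evaluates at `ρ` to `T_ρ(a,b,c)`. [folklore] -/
theorem eval_pencilEntryPoly (ρ : ℂ) (x : Fin 3 × Fin 3 × Fin 3) :
    Polynomial.eval ρ ((fun x : Fin 3 × Fin 3 × Fin 3 =>
        Polynomial.C (if x.2.1 = x.1 + 1 ∧ x.2.2 = x.1 + 2 then (1 : ℂ) else 0) +
          Polynomial.X * Polynomial.C (if x.2.1 = x.1 + 2 ∧ x.2.2 = x.1 + 1 then (1 : ℂ) else 0)) x) =
      tensorEntries (fun a b c : Fin 3 => (if b = a + 1 ∧ c = a + 2 then (1 : ℂ) else 0) +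
        ρ * (if b = a + 2 ∧ c = a + 1 then (1 : ℂ) else 0)) x := by
  simp only [Polynomial.eval_add, Polynomial.eval_C, Polynomial.eval_mul, Polynomial.eval_X,
    tensorEntries]

/-- **Pull-back of a polynomial in the entries along the pencil**: for every polynomial `p` in the
`27` entries, `q = p(T_ρ)` is a univariate polynomial in `ρ`, namely `aeval (entry polynomials) p`,
with `q(ρ) = p(entries of T_ρ)`. [folklore] -/
theorem eval_aeval_pencil (p : MvPolynomial (Fin 3 × Fin 3 × Fin 3) ℂ) (ρ : ℂ) :
    Polynomial.eval ρ (MvPolynomial.aeval (fun x : Fin 3 × Fin 3 × Fin 3 =>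
        Polynomial.C (if x.2.1 = x.1 + 1 ∧ x.2.2 = x.1 + 2 then (1 : ℂ) else 0) +
          Polynomial.X * Polynomial.C (if x.2.1 = x.1 + 2 ∧ x.2.2 = x.1 + 1 then (1 : ℂ) else 0)) p) =
      MvPolynomial.eval (tensorEntries (fun a b c : Fin 3 =>
        (if b = a + 1 ∧ c = a + 2 then (1 : ℂ) else 0) +
          ρ * (if b = a + 2 ∧ c = a + 1 then (1 : ℂ) else 0))) p := by
  rw [← Polynomial.coe_aeval_eq_eval, MvPolynomial.comp_aeval_apply, MvPolynomial.aeval_eq_eval]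
  exact congrArg (fun f : Fin 3 × Fin 3 × Fin 3 → ℂ => MvPolynomial.eval f p)
    (funext fun x => by rw [Polynomial.coe_aeval_eq_eval]; exact eval_pencilEntryPoly ρ x)

/-- **Finite-or-all on the pencil** (CHNVZ 2025 Thm 1.2 restricted to a line): for every real `r`,
the set of `ρ` with `R̃(T_ρ) ≤ r` is either finite or all of `ℂ`. If some `T_{ρ₀}` has `R̃ > r`,
Zariski-closedness of `{R̃ ≤ r}` gives a polynomial in the entries vanishing on the sublevel set and
not at `T_{ρ₀}`; along the pencil it is a NON-ZERO polynomial in `ρ`, whose finitely many roots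
contain the sublevel set. [cite: ChristandlHoeberechtsNieuwboerVranaZuiddam2025, Theorem 1.2] -/
theorem pencil_sublevel_finite_or_all (r : ℝ) :
    Set.Finite {ρ : ℂ | asymptoticRank (fun a b c : Fin 3 =>
        (if b = a + 1 ∧ c = a + 2 then (1 : ℂ) else 0) +
          ρ * (if b = a + 2 ∧ c = a + 1 then (1 : ℂ) else 0)) ≤ r} ∨
      ∀ ρ : ℂ, asymptoticRank (fun a b c : Fin 3 =>
        (if b = a + 1 ∧ c = a + 2 then (1 : ℂ) else 0) +
          ρ * (if b = a + 2 ∧ c = a + 1 then (1 : ℂ) else 0)) ≤ r := by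
  classical
  by_cases hall : ∀ ρ : ℂ, asymptoticRank (fun a b c : Fin 3 =>
      (if b = a + 1 ∧ c = a + 2 then (1 : ℂ) else 0) +
        ρ * (if b = a + 2 ∧ c = a + 1 then (1 : ℂ) else 0)) ≤ r
  · exact Or.inr hall
  left
  push Not at hall
  obtain ⟨ρ₀, hρ₀⟩ := hall
  -- Zariski-closedness, contrapositive: a separating polynomial in the entries
  have hZ := chnvz_zariskiClosed_asymptoticRank_le_holds ℂ (Fin 3) (Fin 3) (Fin 3) r
    (fun a b c : Fin 3 => (if b = a + 1 ∧ c = a + 2 then (1 : ℂ) else 0) +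
      ρ₀ * (if b = a + 2 ∧ c = a + 1 then (1 : ℂ) else 0))
  have hsep : ∃ p : MvPolynomial (Fin 3 × Fin 3 × Fin 3) ℂ,
      (∀ S : Fin 3 → Fin 3 → Fin 3 → ℂ, asymptoticRank S ≤ r →
        MvPolynomial.eval (tensorEntries S) p = 0) ∧
      MvPolynomial.eval (tensorEntries (fun a b c : Fin 3 =>
        (if b = a + 1 ∧ c = a + 2 then (1 : ℂ) else 0) +
          ρ₀ * (if b = a + 2 ∧ c = a + 1 then (1 : ℂ) else 0))) p ≠ 0 := by
    by_contra hno
    push Not at hno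
    exact (not_le.mpr hρ₀) (hZ fun p hp => hno p hp)
  obtain ⟨p, hp, hp₀⟩ := hsep
  -- the univariate pull-back `q(ρ) = p(T_ρ)`
  set q : Polynomial ℂ := MvPolynomial.aeval (fun x : Fin 3 × Fin 3 × Fin 3 =>
      Polynomial.C (if x.2.1 = x.1 + 1 ∧ x.2.2 = x.1 + 2 then (1 : ℂ) else 0) +
        Polynomial.X * Polynomial.C (if x.2.1 = x.1 + 2 ∧ x.2.2 = x.1 + 1 then (1 : ℂ) else 0)) p
    with hq_def
  have hq : ∀ ρ : ℂ, Polynomial.eval ρ q = MvPolynomial.eval (tensorEntries (fun a b c : Fin 3 =>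
      (if b = a + 1 ∧ c = a + 2 then (1 : ℂ) else 0) +
        ρ * (if b = a + 2 ∧ c = a + 1 then (1 : ℂ) else 0))) p := fun ρ => by
    rw [hq_def, eval_aeval_pencil]
  have hq0 : q ≠ 0 := by
    intro h0
    apply hp₀
    rw [← hq ρ₀, h0, Polynomial.eval_zero]
  refine (Polynomial.finite_setOf_isRoot hq0).subset ?_
  intro ρ hρ
  simp only [Set.mem_setOf_eq, Polynomial.IsRoot.def]
  rw [hq ρ]
  exact hp _ hρ

end Semicontinuity

end Summit.MatrixMultiplication.MatrixMultiplication.Theorems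

end
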